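import Mathlib
import Summits.Ventures.HodgeRepro2.T5LocallyConstantDense
import Summits.Ventures.HodgeRepro2.T5MeasureSupOnClopens

/-!
# T5LocallyConstantDetermines — a bounded functional on `C(X, R)`, `X` profinite, is determined by
  its values on locally constant functions: S4's «on locally constant φ (Q5) hence on continuous φ»

Tier-5 support of seat p7 (route/T5-CHECK-G-p7.md §3 S4: «∫φ dL⁻_{Σ,λ⁻¹} = ∫φλ̂⁻¹ dL_{𝔠,Σ} = … on
locally constant φ (Q5) hence on continuous φ»; route/T5-LEAN-p7.md §59).

For `X` compact Hausdorff totally disconnected, `R` a normed ring, and two additive maps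
`m₁ m₂ : C(X, R) → R` with `‖mᵢ φ‖ ≤ C ‖φ‖` («𝒪-valued measures», `C = 1`):
* `norm_apply_le_of_forall_locallyConstant` — if `m` is bounded and `‖m g‖ ≤ S` on every locally
  constant `g` then `‖m φ‖ ≤ S` on every continuous `φ` (density, T5LocallyConstantDense);
* `eq_of_forall_locallyConstant` — **two bounded additive functionals agreeing on locally constant
  functions are equal**; `eq_of_forall_indicator` — for `R`-linear functionals it suffices that they
  agree on the indicators of clopen sets (a locally constant function is a finite sum of those,
  T5MeasureSupOnClopens.toContinuousMap_eq_sum).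

Nothing about the printed measures is asserted (Q5 itself — the pull-back identity on locally
constant functions — is the prose's); this is the «hence on continuous φ».  Axioms: standard.
README §8(d): uses an L-value-free non-vanishing device: NO.
-/

namespace Summit.Ventures.HodgeRepro2.T5LocallyConstantDetermines

open Set T5LocallyConstantDense T5MeasureSupOnClopens

variable {X : Type*} [TopologicalSpace X] [CompactSpace X] [T2Space X] [TotallyDisconnectedSpace X]
variable {R : Type*} [NormedRing R]

/-- If `‖m g‖ ≤ S` on every locally constant `g` and `m` is bounded, then `‖m φ‖ ≤ S` on every
continuous `φ` (approximate `φ` by `g`, `‖m φ‖ ≤ ‖m g‖ + ‖m (φ − g)‖ ≤ S + C ε`). -/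
theorem norm_apply_le_of_forall_locallyConstant (m : C(X, R) →+ R) {C : ℝ} (hC : 0 ≤ C)
    (hm : ∀ φ, ‖m φ‖ ≤ C * ‖φ‖) {S : ℝ}
    (hS : ∀ g : LocallyConstant X R, ‖m g.toContinuousMap‖ ≤ S) (φ : C(X, R)) : ‖m φ‖ ≤ S := by
  apply le_of_forall_pos_le_add
  intro ε hε
  have hε' : 0 < ε / (C + 1) := div_pos hε (by linarith)
  obtain ⟨g, hg⟩ := exists_locallyConstant_dist_lt φ hε'
  have hsub : ‖φ - g.toContinuousMap‖ ≤ ε / (C + 1) := by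
    rw [ContinuousMap.norm_le _ hε'.le]
    intro x
    rw [ContinuousMap.sub_apply, LocallyConstant.coe_continuousMap, ← dist_eq_norm]
    exact (hg x).le
  have hφ : m φ = m g.toContinuousMap + m (φ - g.toContinuousMap) := by
    rw [← map_add, add_sub_cancel]
  have h2 : ‖m (φ - g.toContinuousMap)‖ ≤ ε := by
    calc ‖m (φ - g.toContinuousMap)‖ ≤ C * ‖φ - g.toContinuousMap‖ := hm _
      _ ≤ C * (ε / (C + 1)) := mul_le_mul_of_nonneg_left hsub hC
      _ ≤ ε := by
          rw [mul_div_assoc', div_le_iff₀ (by linarith)]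
          nlinarith
  rw [hφ]
  calc ‖m g.toContinuousMap + m (φ - g.toContinuousMap)‖
      ≤ ‖m g.toContinuousMap‖ + ‖m (φ - g.toContinuousMap)‖ := norm_add_le _ _
    _ ≤ S + ε := add_le_add (hS g) h2

/-- A bounded additive functional vanishing on locally constant functions vanishes. -/
theorem eq_zero_of_forall_locallyConstant (m : C(X, R) →+ R) {C : ℝ} (hC : 0 ≤ C)
    (hm : ∀ φ, ‖m φ‖ ≤ C * ‖φ‖) (h0 : ∀ g : LocallyConstant X R, m g.toContinuousMap = 0) :
    m = 0 := by
  ext φ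
  rw [AddMonoidHom.zero_apply, ← norm_le_zero_iff]
  exact norm_apply_le_of_forall_locallyConstant m hC hm (fun g => by rw [h0 g, norm_zero]) φ

/-- **S4's «hence on continuous φ»**: two bounded additive functionals on `C(X, R)` that agree on
every locally constant function agree everywhere. -/
theorem eq_of_forall_locallyConstant (m₁ m₂ : C(X, R) →+ R) {C : ℝ} (hC : 0 ≤ C)
    (hm₁ : ∀ φ, ‖m₁ φ‖ ≤ C * ‖φ‖) (hm₂ : ∀ φ, ‖m₂ φ‖ ≤ C * ‖φ‖)
    (h : ∀ g : LocallyConstant X R, m₁ g.toContinuousMap = m₂ g.toContinuousMap) : m₁ = m₂ := by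
  have hsub : ∀ φ, ‖(m₁ - m₂) φ‖ ≤ (C + C) * ‖φ‖ := by
    intro φ
    rw [AddMonoidHom.sub_apply, add_mul]
    exact (norm_sub_le _ _).trans (add_le_add (hm₁ φ) (hm₂ φ))
  have := eq_zero_of_forall_locallyConstant (m₁ - m₂) (by linarith) hsub
    (fun g => by rw [AddMonoidHom.sub_apply, h g, sub_self])
  exact sub_eq_zero.mp this

/-- The same for `R`-linear functionals, with agreement on the indicators of clopen sets only
(a locally constant function is `∑_v v • 1_{g⁻¹ v}`, the fibres clopen). -/
theorem eq_of_forall_indicator (m₁ m₂ : C(X, R) →ₗ[R] R) {C : ℝ} (hC : 0 ≤ C)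
    (hm₁ : ∀ φ, ‖m₁ φ‖ ≤ C * ‖φ‖) (hm₂ : ∀ φ, ‖m₂ φ‖ ≤ C * ‖φ‖)
    (h : ∀ U : Set X, IsClopen U → m₁ (indicatorCM U) = m₂ (indicatorCM U)) : m₁ = m₂ := by
  have hg : ∀ g : LocallyConstant X R, m₁ g.toContinuousMap = m₂ g.toContinuousMap := by
    intro g
    rw [toContinuousMap_eq_sum, map_sum, map_sum]
    refine Finset.sum_congr rfl fun v _ => ?_
    rw [map_smul, map_smul, h _ (isClopen_fiber g v)]
  have := eq_of_forall_locallyConstant m₁.toAddMonoidHom m₂.toAddMonoidHom hC hm₁ hm₂ hg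
  exact LinearMap.toAddMonoidHom_injective this

end Summit.Ventures.HodgeRepro2.T5LocallyConstantDetermines
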